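import Summits.NavierStokesRegularity.OSWSelfSimilar.OSWMechanism02
import HarnessLib

/-!
# OSW self-similar mechanism: local theory at the antipode, quantisation, the a → 1 branch (MECHANISM.md §§1–28: THEOREMS M1–M31) — part 03 of 26

1-D model (gCLM/OSW), computer-assisted; not Euler/NS.  Filed under `Summits/NavierStokesRegularity/OSWSelfSimilar/` by a prover-role courier on behalf of the
mechanism seat pub-oswblow-mech (planner-pub-oswblow-mech-g29-0), cell pub-oswblow (host summit NavierStokesRegularity); the gate admits the path but
not role planner.  CONTENT = the staged transcript `pub-oswblow-mech/lean/OSWMechanism.lean` (sha256 9c32c87eb2d21b32…,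
8958 lines), source lines 735–1104, UNCHANGED except: (i) namespace prefix `OSWSelfSimilar.Mechanism` → `Summit.NavierStokesRegularity.OSWSelfSimilar.Mechanism`;
(ii) the frames open at the cut (section (anonymous) › namespace Summit.NavierStokesRegularity.OSWSelfSimilar.Mechanism) are re-opened above the body with their `open` commands replayed, and closed
at the end; (iii) this docstring.  Generated by `pub-oswblow-mech/lean/courier/make_split.py`; the parts must be filed IN ORDER
(each imports its predecessor).  First/last declarations here: `M11Statement` … `jetDiag_one` (31 in this part).
AI-written transcript; kernel-checked on the farm as ONE file before splitting (see the kit's CHECKS); to be checked, not trusted.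
COURIER NOTE (prover-role courier seat pub-oswblow-courier g2, 2026-08-25): in addition to the changes listed above, 1 one-line docstrings were added at filing on the declarations the transcript left undocumented (tree docstring rule); each only restates the formal statement of its declaration; nothing else was touched. List of the added docstrings: HOME `pub-oswblow-courier/g2/DOCSTRINGS.tsv`.
-/

noncomputable section
open Complex Set Filter
open scoped Topology
open Literature.Analysis.FluidPDE.OkamotoSakajoWunsch2008
namespace Summit.NavierStokesRegularity.OSWSelfSimilar.Mechanism

/-- **Corollary M11 (iii) (the projective line: smooth ⇔ analytic ⇔ both rungs odd)** — proved in
MECHANISM.md §13.7, not kernel-checked.  Under `LineChartHyp`, if the transport coefficient vanishes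
on `(-π, π)` only at `0` (the self-similar velocity `αξ + aG` vanishes only at `ξ = 0`) and
`T'(0) = α + a h(0) ≠ 0`, then `f ∈ C^∞(ℝ/2πℤ)` iff `f` is real-analytic (`Φ ∈ C^∞(ℝP¹) ⇔ Φ ∈
C^ω(ℝP¹)`), and this holds iff `q₀` is odd and (`1/α ∈ {3,5,7,…}` or `(α, a) = (1, 0)`). -/
def M11Statement : Prop :=
  ∀ (α a : ℝ) (c : ℤ → ℂ), LineChartHyp α a c →
    (∀ q : ℝ, -Real.pi < q → q < Real.pi → (transportLine α a c q = 0 ↔ q = 0)) →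
    α + a * hLine c 0 ≠ 0 →
    (ContDiff ℝ (⊤ : ℕ∞) (fR c) ↔ AnalyticOnNhd ℝ (fR c) univ) ∧
    (AnalyticOnNhd ℝ (fR c) univ ↔
      (∃ m : ℕ, lineOriginExponent α a c = 2 * (m : ℝ) + 1) ∧
        ((∃ n : ℕ, 1 / α = 2 * (n : ℝ) + 3) ∨ (α = 1 ∧ a = 0)))

/-- **Corollary M11 (iv) (on the line alone)** — MECHANISM.md §13.7, not kernel-checked: under the
hypotheses of `M11Statement`, `f` is real-analytic on `(-π, π)` (`Φ ∈ C^ω(ℝ)`) iff `q₀` is odd —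
in particular whenever `f'(0) ≠ 0` (Elgindi–Jeong's Remark 3.4 for profiles with simple stagnation
set; LSS's numerical "real analytic for `a < a_c`"). -/
def M11LineStatement : Prop :=
  ∀ (α a : ℝ) (c : ℤ → ℂ), LineChartHyp α a c →
    (∀ q : ℝ, -Real.pi < q → q < Real.pi → (transportLine α a c q = 0 ↔ q = 0)) →
    α + a * hLine c 0 ≠ 0 →
    (AnalyticOnNhd ℝ (fR c) (Ioo (-Real.pi) Real.pi) ↔
      ∃ m : ℕ, lineOriginExponent α a c = 2 * (m : ℝ) + 1)

/-- The v6 mechanism statement: v5 together with the mirror statements of §10 and the analyticity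
statements of §13 (Lemma 13.3, Prop. 13.4, M10, M11). -/
def MechanismStatementV6 : Prop :=
  MechanismStatementV5 ∧ MirrorMechanismStatement ∧ LineInteriorAnalyticStatement ∧
    OriginLineStatement ∧ M10Statement ∧ M10IffStatement ∧ M11Statement ∧ M11LineStatement

/-- **(13.9), kernel-checked algebra.**  At the point at infinity the zeroth-order coefficient
vanishes (`h(π) = 0`) and the transport coefficient has slope `T'(π) = -α` (Lemma 10.2), so the
equilibrium condition `Q^∞(0; γ, μ) = (h(π) - 1)/T'(π) - s = 0` of the weighted Briot–Bouquet system
`(S^∞)` of MECHANISM.md §13.5 — for EVERY `(γ, μ)` — is the indicial law at infinity `s = 1/α`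
(meaningful for `α ≠ 0`; the displayed equivalence holds for every real `α` by the `x / 0 = 0`
convention). -/
theorem indicialQinf_zero_iff (α s : ℝ) :
    (0 - 1) / (-α) - s = 0 ↔ s = 1 / α := by
  have key : ((0 : ℝ) - 1) / (-α) = 1 / α := by
    rw [zero_sub, neg_div_neg_eq]
  rw [key]
  constructor
  · intro h
    linarith
  · intro h
    rw [h]
    ring

/-- **Prop. 13.4 (b), kernel-checked algebra.**  The exponent at the origin of the line,
`q₀ = (H - 1)/(α + aH)` with `H = H_ℝΦ(0)`, equals `1` — the case `Φ'(0) ≠ 0` — iff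
`α = (1 - a)H - 1`: Huang–Qin–Wang–Wei's relation `c_l = c_ω + (1 - a)u'(0)` in the normalisation
`c_ω = -1` (MECHANISM.md §10.1). -/
theorem originLine_exponent_one_iff (α a H : ℝ) (h : α + a * H ≠ 0) :
    (H - 1) / (α + a * H) = 1 ↔ α = (1 - a) * H - 1 := by
  rw [div_eq_one_iff_eq h]
  constructor
  · intro h1
    linarith
  · intro h1
    linarith

/-! ## v7 (gen 8): non-degeneracy of the rungs in the smooth class (MECHANISM.md §14, Theorem M12)

Proved in MECHANISM.md §14 with pen and paper, NOT kernel-checked, from the cell's §11–§13 machinery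
plus ONE input from the computer-assisted certificate: FRAME F-12.3 certifies that the frame's
linearisation `DF(x*)` is *bijective* on the weighted space `ℓ¹_{5/4}` (kernel-checked contraction
`CertificateFamily.Z_lt_one` + `RadiiPolynomial.isInvertible_comp_of_newtonLike`).  Lemma 14.1 transfers
bijectivity to every strip width `ν ∈ (1, 5/4]`; Lemma 14.2 intertwines `DF(x*)` with the profile-side
linearisation `𝓛 = D𝓕(f*, a*)` of Theorem M7 through the singular operator
`ℬψ = (sin x ψ' - ψ)/a + G (Hf ψ' - H(fψ)')`; Lemma 14.3 identifies `ker ℬ` on analytic data with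
the Fuchsian ODE `sin x ψ' + ψ/G = ρ̃` at the antipode (exponent `q = Pa - 1`), a datum being in the
range iff its obstruction functional `ℓ(ρ)` — the Hadamard finite part of `∫₀^π ρ |f*|^{-a}` —
vanishes; at `P = 3` the relevant value is a convergent integral of a positive function (Prop. 14.4;
the exponent inequalities on the certified ball are `rung3_obstruction_exponents` below), at `P ≥ 5`
its non-vanishing is the numerical hypothesis R3(P) (§14.9).  Lemmas 14.5–14.6 and Prop. 14.7: a
kernel vector `(φ, ȧ)` of `𝓛` in any Hölder class is analytic, with a zero of order `P` at `π`, as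
soon as its *log-residue* `Λ(φ, ȧ) = -P ȧ/a + Hφ(π)/(a η²)` vanishes — the v5/v6 Briot–Bouquet device
run on the LINEARISED equation, whose compatibility condition at the saddle-node is `μ₀ Λ = 0`
(`linBB_compat_eq_logResidue`, with `κ = -μ₀P/λ₀ = μ₀β₀`, `linBB_kappa_eq`).  THEOREM M12: at every
certified rung satisfying R3 (unconditionally at `P = 3`): (a) `𝓛` is a Banach isomorphism of
`X^{k,β} × ℝ` onto `Y^{k,β}` for every `k ≥ P` — the rung is an isolated, non-degenerate solution of
(T1) in the smooth class; (b) on `X^{P-1,β} × ℝ`, `𝓛` is onto with kernel `ℝ(χ₀, ḃ₀)`,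
`Λ(χ₀, ḃ₀) = 1` (the count is `indexOne_count`), and the nearby solutions of (T1) form one
real-analytic curve along which the antipodal exponent satisfies `p(0) = P`, `dp/dt(0) = 1`
(`logResidue_eq_pdot_along_curve`, `pdot_eq_logResidue`): the quantisation condition is met
transversally; (c) (N1) ⇔ `ḃ₀ ≠ 0`, and then `ṗ = 1/ḃ₀` (`ḃ₀ ∈ ℝ` = the `ȧ`-component of the kernel vector; NOT §12.3's constant `β₀` below — referee W-M22).  M12 is NOT typed here (its objects — the
Hölder scale, the map `𝓕`, FRAME's `ℓ¹_ν` operators — are outside this file's vocabulary). -/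

/-- **Lemma 14.2 / Prop. 14.7, kernel-checked algebra.**  In the weighted linearised Briot–Bouquet
system (14.13) at the antipode, `A(0) = [[-1, 0], [κ, 0]]` with `κ = -μ₀ P / λ₀`, where
`λ₀ = 2iη` (`η = Hf(π)`) and `P = (η - 1)/(a η)` is the rung's exponent; this equals `μ₀ β₀` with
`β₀ = i(η - 1)/(2 a η²)` as in §12.3. -/
theorem linBB_kappa_eq (a η μ₀ : ℂ) (ha : a ≠ 0) (hη : η ≠ 0) :
    -(μ₀ * ((η - 1) / (a * η))) / (2 * I * η) = μ₀ * (I * (η - 1) / (2 * a * η ^ 2)) := by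
  have hI0 : (I : ℂ) ≠ 0 := Complex.I_ne_zero
  field_simp
  ring_nf
  simp only [Complex.I_sq]
  ring

/-- **Prop. 14.7, kernel-checked algebra (the compatibility condition IS the log-residue).**  With the
one-sided data `b₁(0) = 2Φ(0) = 2iH` (`H = Hφ(π)`), `λ₀ = 2iη`,
`b₂(0) = μ₀ (2Φ(0)/(a λ₀) - ȧ P/a)` and `κ = μ₀ β₀`, the compatibility scalar `κ b₁(0) + b₂(0)` of the
linear Briot–Bouquet lemma 14.6 equals `μ₀ · Λ(φ, ȧ)` with `Λ(φ, ȧ) = -P ȧ/a + H/(a η²)` (14.8). -/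
theorem linBB_compat_eq_logResidue (a η μ₀ H adot P : ℂ) (ha : a ≠ 0) (hη : η ≠ 0) :
    (μ₀ * (I * (η - 1) / (2 * a * η ^ 2))) * (2 * I * H)
      + μ₀ * ((2 * I * H) / (a * (2 * I * η)) - adot * P / a)
    = μ₀ * (-P * adot / a + H / (a * η ^ 2)) := by
  have hI0 : (I : ℂ) ≠ 0 := Complex.I_ne_zero
  field_simp
  ring_nf
  simp only [Complex.I_sq]
  ring

/-- **Theorem M12(b) / Prop. 11.6, kernel-checked calculus.**  Along a `C¹` curve of solutions
`t ↦ (f_t, b(t))` the antipodal exponent is `p(t) = (1 - 1/η(t))/b(t)` with `η(t) = Hf_t(π)`; its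
derivative is `η'/(b η²) - (1 - 1/η) b'/b²`. -/
theorem logResidue_eq_pdot_along_curve {η b : ℝ → ℝ} {η' b' t : ℝ}
    (hη : HasDerivAt η η' t) (hb : HasDerivAt b b' t) (hη0 : η t ≠ 0) (hb0 : b t ≠ 0) :
    HasDerivAt (fun s => (1 - (η s)⁻¹) / b s)
      (η' / (b t * η t ^ 2) - (1 - (η t)⁻¹) * b' / b t ^ 2) t := by
  have h1 : HasDerivAt (fun s => 1 - (η s)⁻¹) (0 - (-η' / η t ^ 2)) t :=
    (hasDerivAt_const t (1 : ℝ)).sub (hη.inv hη0)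
  have h2 := h1.div hb hb0
  refine h2.congr_deriv ?_
  field_simp
  ring

/-- … and at a rung, where `(1 - 1/η)/b = P`, that derivative is the LOG-RESIDUE
`Λ(φ, ḃ) = -P ḃ/b + Hφ(π)/(b η²)` of the tangent `(φ, ḃ) = d/dt (f_t, b(t))` (`η' = Hφ(π)`):
`dp/dt = Λ` (M12(b)); with `ḃ = 1` this is `ṗ = Λ(ḟ, 1)` (Prop. 11.6(ii), cf. `residue_eq_pdot`). -/
theorem pdot_eq_logResidue (η₀ b₀ η' b' P : ℝ) (hη0 : η₀ ≠ 0) (hb0 : b₀ ≠ 0)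
    (hq : (1 - η₀⁻¹) / b₀ = P) :
    η' / (b₀ * η₀ ^ 2) - (1 - η₀⁻¹) * b' / b₀ ^ 2 = -P * b' / b₀ + η' / (b₀ * η₀ ^ 2) := by
  rw [← hq]
  field_simp
  ring

/-- **Theorem M12(b), the count.**  On `X^{P-1,β} × ℝ` the linearisation has index `+1`
(`indexFull (P-1) P = 1`), i.e. `dim ker - codim range = 1`; the log-residue is injective on the
kernel (a kernel vector with `Λ = 0` is analytic, hence lies in the `X^{P,β}`-kernel, which is `0` by
M12(a)), so `dim ker ≤ 1`.  Hence `dim ker = 1` and the map is onto. -/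
theorem indexOne_count (dimKer codim : ℕ) (hidx : (dimKer : ℤ) - codim = 1) (hle : dimKer ≤ 1) :
    dimKer = 1 ∧ codim = 0 := by
  omega

/-- The index count of Theorem M12(b): `indexFull (P-1) P = 1` for `3 ≤ P`. -/
theorem indexFull_at_Pminus1 {P : ℕ} (hP : 3 ≤ P) : indexFull (P - 1) P = 1 := by
  unfold indexFull indexLloc
  have h1 : 1 ≤ P - 1 := by omega
  have h2 : ¬ (P ≤ P - 1) := by omega
  simp [h1, h2]

/-- **Prop. 14.4, the exponents on the certified ball (kernel-checked from the certificate).**  For every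
`a` in the certified `P = 3` ball `[ā - 10⁻⁵², ā + 10⁻⁵²]` (`CertificateP3.window_contains_ball`:
it lies in `[0.755272287, 0.755272288]`), the antipodal exponent of the obstruction ODE `q = 3a - 1`
lies in `(1, 2)` — so no even resonance and `rank c₋ ≤ 1` needs the single value `ℓ₁₀` — and the
integrand of `ℓ₁₀`, which is `≍ s^{2-3a}` at the antipode and `≍ t^{-a}` at the origin, is integrable:
`2 - 3a > -1`, `0 < a < 1`.  This is the arithmetic half of "R3 holds at the first rung structurally". -/
theorem rung3_obstruction_exponents (a : ℝ)
    (ha : CertificateP3.abar - CertificateP3.radius ≤ a ∧ a ≤ CertificateP3.abar + CertificateP3.radius) :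
    1 < 3 * a - 1 ∧ 3 * a - 1 < 2 ∧ -1 < 2 - 3 * a ∧ 0 < a ∧ a < 1 := by
  obtain ⟨hlo, hhi⟩ := CertificateP3.window_contains_ball
  obtain ⟨h1, h2⟩ := ha
  refine ⟨by linarith, by linarith, by linarith, by linarith, by linarith⟩


/-! ## v8 (gen 9): the Hölder branch in frame coordinates — (N1) as one real number (MECHANISM.md §15, Theorem M13)

Proved in MECHANISM.md §15 with pen and paper, NOT kernel-checked.  Theorem M12 left ONE local
hypothesis at the certified rungs: (N1) ⇔ `ḃ₀ ≠ 0` for the kernel vector `(χ₀, ḃ₀)` of `𝓛` on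
`X^{P-1,β} × ℝ` (log-residue `Λ = 1`).  §15 extends FRAME's map `F_P` by one non-analytic direction —
the antipodal factor `cos^P(x/2)` of `w_n` is replaced by `|cos(x/2)|^{p(x)}` with
`p(x) = (1 + 1/G(π))/b` the exponent the indicial law demands — to a "Hölder frame" `(𝔉₁, F₂)` whose
zeros are exactly the profiles of the Hölder branch (Lemma 15.1: the structure identity F-12.1 with the
`F₃`-term absorbed into the exponent; the scalar identity behind it is `holderFrame_bracket` below).
Its linearisation at the rung is `DF_P(x*)` corrected by the rank-one term `(DF₃/(a G(π)))·S`,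
`S = L[f* · log|cos(x/2)|]` (Prop. 15.2; `deltaP_eq_neg_DF3`), and THEOREM M13 says: the frame
coordinates `t⁰ = (Lχ₀, δκ₀, ḃ₀)` of the kernel vector form THE solution, in the finite-regularity
class `𝒦_P × ℝ²` (`𝒦_P = L(X^{P-1,β})`), of the linear system `DF_P(x*) t⁰ = (S, 0, -a* G*(π))`, and
`DF_P(x*)` is injective on that class (extending the certified injectivity (R) beyond analytic
perturbations).  Hence (N1) ⇔ `t⁰_a ≠ 0`, `ṗ(a*_P) = 1/t⁰_a`, with the two-term structure
`ḃ₀ = t^S_a - a* G*(π) v*_a` (`v* = DF_P(x*)⁻¹ e₃` analytic and enclosable from the existing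
certificate; only `t^S` carries the non-analytic datum) and the dimensionless form
`ḃ₀ = -a* G*(π) v*_a (1 - 𝔮)` (`bdot0_eq_of_qfrak`).  Numerically (§15.7, two code-disjoint routes,
double precision, used in no proof): `t⁰_a = -0.02689945764`, `𝔮 = 0.6926377`.  (N1) REMAINS A
HYPOTHESIS; M13 is NOT typed here (same reason as M12).  v8 also RECORDS (MECHANISM.md §14.9 note,
Remark 15.5(d)) that hypothesis R3(P) of Theorem M12 at `P = 5, …, 25` is no longer numerical: it is the
certified sign `(C2)_P` of FRAME.md v1.6 §14 (w2a gen 6; two implementations sharing no code; not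
kernel-checked), so M12 and M13 hold at all twelve certified rungs conditionally on those certificates. -/

/-- **Lemma 15.1(a) and Remark (1), kernel-checked algebra (the logarithmic-derivative defect of the
Hölder frame).**  Write `d = G'(x)·sin x`, `c = cos x`, `G0 = G(0)`, `Gpi = G(π)`.  On `(0, π)`,
`b·G sin x·(f^{ext})'/f^{ext} = d - 1 + G(1+c)/(2 G0) + G(1-c)/(2 Gpi) + bG(1+c)/2 - b p G(1-c)/2`
(from `u' = G'/G - Div(1/G)` and `(log w)' `), while the target
`h_G - 1 - G F₂ (1+c)/(2 G0)` with `F₂ = (1-b) G0 - 1` is `d + Gc - 1 - G((1-b)G0 - 1)(1+c)/(2 G0)`.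
Their difference is `G(1-c)/2 · (1 + 1/G(π) - b p)`. -/
theorem holderFrame_bracket (G d c G0 Gpi b p : ℝ) (hG0 : G0 ≠ 0) (hGpi : Gpi ≠ 0) :
    (d - 1 + G * (1 + c) / (2 * G0) + G * (1 - c) / (2 * Gpi) + b * G * (1 + c) / 2
        - b * p * G * (1 - c) / 2)
      - (d + G * c - 1 - G * ((1 - b) * G0 - 1) * (1 + c) / (2 * G0))
    = G * (1 - c) / 2 * (1 + 1 / Gpi - b * p) := by
  field_simp
  ring

/-- … which vanishes for the Hölder frame's exponent `p = p(x) = (1 + 1/G(π))/b` (Lemma 15.1(a)) … -/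
theorem holderFrame_bracket_zero (G c Gpi b : ℝ) (hGpi : Gpi ≠ 0) (hb : b ≠ 0) :
    G * (1 - c) / 2 * (1 + 1 / Gpi - b * ((1 + 1 / Gpi) / b)) = 0 := by
  have h : b * ((1 + 1 / Gpi) / b) = 1 + 1 / Gpi := by field_simp
  rw [h]
  ring

/-- … and equals `-G·F₃·(1 - cos x)/(2 G(π))`, `F₃ = (P b - 1) G(π) - 1`, for the frozen exponent
`p = P` — FRAME's structure identity F-12.1 (Lemma 15.1, Remark (1)). -/
theorem frozenFrame_bracket (G c Gpi b P : ℝ) (hGpi : Gpi ≠ 0) :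
    G * (1 - c) / 2 * (1 + 1 / Gpi - b * P)
      = -(G * ((P * b - 1) * Gpi - 1) * (1 - c) / (2 * Gpi)) := by
  field_simp
  ring

/-- **Prop. 15.2(i), kernel-checked algebra.**  At a zero of `F_P` (`G(π)(Pa - 1) = 1`) the derivative
of the exponent `p(x) = (1 + 1/G(π))/b` in the direction `t = (m, δκ, δa)` is
`δp[t] = -m(π)/(a G(π)²) - P δa/a = -DF₃(x*)[t]/(a G(π))`, `DF₃[t] = (Pa - 1) m(π) + P G(π) δa`. -/
theorem deltaP_eq_neg_DF3 (a Gpi P mpi da : ℝ) (ha : a ≠ 0) (hGpi : Gpi ≠ 0)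
    (hq : Gpi * (P * a - 1) = 1) :
    -mpi / (a * Gpi ^ 2) - P * da / a = -((P * a - 1) * mpi + P * Gpi * da) / (a * Gpi) := by
  have h1 : P * a - 1 = 1 / Gpi := (eq_div_iff hGpi).mpr (by linear_combination hq)
  rw [h1]
  field_simp
  ring

/-- **Remark 15.5(a), kernel-checked bookkeeping (the dimensionless form of (N1)).**  With
`v = v*_a`, `tS = t^S_a`, `tG = t♯_G(π)` (the fixed-parameter frame tangent), `q = 𝔮 = δp[t♯]` and
`b0 = ḃ₀`: from `t^S_a = -v*_a·DF₃[t♯]`, `DF₃[t♯] = (Pa - 1) t♯_G(π)`, `𝔮 = -(Pa-1)² t♯_G(π)/a`,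
(15.9) `ḃ₀ = t^S_a - a G(π) v*_a` and `G(π)(Pa - 1) = 1` one gets `t^S_a = a G(π) v*_a 𝔮` and
`ḃ₀ = -a G(π) v*_a (1 - 𝔮)`: given `v*_a ≠ 0`, (N1) ⇔ `𝔮 ≠ 1`. -/
theorem bdot0_eq_of_qfrak (a Gpi P v tS tG q b0 : ℝ) (ha : a ≠ 0) (hGpi : Gpi ≠ 0)
    (hq : Gpi * (P * a - 1) = 1)
    (htS : tS = -v * ((P * a - 1) * tG))
    (hqdef : q = -(P * a - 1) ^ 2 * tG / a)
    (hb0 : b0 = tS - a * Gpi * v) :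
    tS = a * Gpi * v * q ∧ b0 = -(a * Gpi * v) * (1 - q) := by
  have h1 : P * a - 1 = 1 / Gpi := (eq_div_iff hGpi).mpr (by linear_combination hq)
  refine ⟨?_, ?_⟩
  · rw [htS, hqdef, h1]
    field_simp
  · rw [hb0, htS, hqdef, h1]
    field_simp
    ring

/-- … so that, given `v*_a ≠ 0` and `a G(π) ≠ 0`, `ḃ₀ ≠ 0 ↔ 𝔮 ≠ 1`. -/
theorem N1_iff_qfrak_ne_one (a Gpi v q b0 : ℝ) (ha : a ≠ 0) (hGpi : Gpi ≠ 0) (hv : v ≠ 0)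
    (hb0 : b0 = -(a * Gpi * v) * (1 - q)) :
    b0 ≠ 0 ↔ q ≠ 1 := by
  rw [hb0]
  have hc : a * Gpi * v ≠ 0 := mul_ne_zero (mul_ne_zero ha hGpi) hv
  constructor
  · intro h hq1
    apply h
    rw [hq1]
    ring
  · intro h h0
    apply h
    have : (1 - q) = 0 := by
      rcases mul_eq_zero.mp h0 with h' | h'
      · exact absurd (neg_eq_zero.mp h') hc
      · exact h'
    linarith

/-! ## v9: the dynamical meaning of `p(a)` — local rates, the spectral strip, jets and the radius law
(MECHANISM.md §16: Lemma 16.1, Theorem M14, Proposition 16.2, Proposition 16.5, Conjecture M15)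

Theorem M14 (the essential spectrum of the linearised similarity-variable flow on `X^{k,β}` is the
closed vertical strip between the two local rates below, with the Fredholm index off the strip given
by `indexM14`) and Propositions 16.2 / 16.5 are proved in MECHANISM.md §16 with pen and paper and are
NOT typed here (they are statements about unbounded operators on Hölder spaces).  What follows is the
algebra they turn on: the two rate functions, their common value `-1` at `s = 1/a`, the factorisation
of the sink rate through the antipodal exponent `p(a)`, the stability window `1 < s < p(a)`, the
diagonal jet rate, the radius-law exponent `α₃(a) = a·G(π) = a/(a·p(a) - 1)`, and the consistency of
the index count with `indexLloc` of v4 at `λ = 0`.  Notation: `Gpi = G(π) = -Hf(π) = |η| > 0`. -/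

/-- §16 (16.2): the SOURCE rate at `x = 0` seen on functions of local Hölder order `s` there,
`λ₀(s) = a(1-s)/(1-a)` (the generalised eigenfunction `|x|^s` of the local transport part). -/
def rateZero (a s : ℝ) : ℝ := a * (1 - s) / (1 - a)

/-- §16 (16.2): the SINK rate at `x = π` seen on functions of local Hölder order `s` there,
`λ_π(s) = a·G(π)·s - G(π) - 1` (the generalised eigenfunction `|x-π|^s`). -/
def ratePi (a Gpi s : ℝ) : ℝ := a * Gpi * s - Gpi - 1

/-- The antipodal exponent written through `G(π) = |Hf(π)|`: `p = (1 + 1/G(π))/a`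
(= `antipodalExponent` with `Hf(π) = -G(π)`). -/
def pOfG (a Gpi : ℝ) : ℝ := (1 + 1 / Gpi) / a

/-- §16 (16.5): the radius-law exponent `α₃(a) = a·G(π)`. -/
def alpha3 (a Gpi : ℝ) : ℝ := a * Gpi

/-- (16.2′): the sink rate factorises through the antipodal exponent, `λ_π(s) = a·G(π)·(s - p)`;
so `p(a)` is exactly the Hölder order at which the sink rate changes sign. -/
theorem ratePi_eq_factor (a Gpi s : ℝ) (ha : a ≠ 0) (hG : Gpi ≠ 0) :
    ratePi a Gpi s = a * Gpi * (s - pOfG a Gpi) := by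
  unfold ratePi pOfG
  field_simp
  ring

/-- `pOfG` agrees with the v1 antipodal exponent `p = (1 - 1/Hf(π))/a` at `Hf(π) = -G(π)`. -/
theorem pOfG_eq_antipodal (a Gpi : ℝ) : pOfG a Gpi = (1 - 1 / (-Gpi)) / a := by
  unfold pOfG
  ring

/-- (16.3): the two rate lines cross at `s = 1/a`, where both equal `-1`, for EVERY `a` and `G(π)`:
the source line … -/
theorem rateZero_at_inv (a : ℝ) (ha : a ≠ 0) (ha1 : a ≠ 1) : rateZero a (1 / a) = -1 := by
  unfold rateZero
  have h1 : (1 - a) ≠ 0 := sub_ne_zero.mpr (Ne.symm ha1)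
  field_simp
  ring

/-- … and the sink line.  Hence `-1` is the optimal essential abscissa over all `X^{k,β}`
(Corollary 16.3(i)); it is the line `Re λ = -1` of SCOPE-CAPFLUIDS §5.10, whose generalised
eigenfunctions `g^{1/a} e^{-iωθ}` are the `s = 1/a` members of the family of Lemma 16.1. -/
theorem ratePi_at_inv (a Gpi : ℝ) (ha : a ≠ 0) : ratePi a Gpi (1 / a) = -1 := by
  unfold ratePi
  field_simp
  ring

/-- The source rate is negative iff `s > 1` (`0 < a < 1`). -/
theorem rateZero_neg_iff (a s : ℝ) (ha0 : 0 < a) (ha1 : a < 1) : rateZero a s < 0 ↔ 1 < s := by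
  unfold rateZero
  have h1 : 0 < 1 - a := by linarith
  rw [div_lt_iff₀ h1]
  constructor
  · intro h
    nlinarith
  · intro h
    nlinarith

/-- The sink rate is negative iff `s < p(a)` (`a > 0`, `G(π) > 0`). -/
theorem ratePi_neg_iff (a Gpi s : ℝ) (ha0 : 0 < a) (hG : 0 < Gpi) :
    ratePi a Gpi s < 0 ↔ s < pOfG a Gpi := by
  have hp : pOfG a Gpi = (Gpi + 1) / (a * Gpi) := by
    unfold pOfG
    field_simp
  rw [hp, lt_div_iff₀ (by positivity)]
  unfold ratePi
  have : s * (a * Gpi) = a * Gpi * s := by ring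
  constructor
  · intro h
    linarith
  · intro h
    linarith

/-- Corollary 16.3(i), the STABILITY WINDOW: both local rates are negative (the essential strip of
Theorem M14 lies in the open left half-plane) iff `1 < s < p(a)`. -/
theorem window_iff (a Gpi s : ℝ) (ha0 : 0 < a) (ha1 : a < 1) (hG : 0 < Gpi) :
    (rateZero a s < 0 ∧ ratePi a Gpi s < 0) ↔ (1 < s ∧ s < pOfG a Gpi) := by
  rw [rateZero_neg_iff a s ha0 ha1, ratePi_neg_iff a Gpi s ha0 hG]

/-- Proposition 16.2, the diagonal coefficient of the exact jet system at the antipode: with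
`c = -1` (f-units) and `η = Hf(π) = -G(π)`, the order-`j` jet rate `c + (1 - a j)·η` equals
`λ_π(j)`; in particular it vanishes exactly at `j = p(a)` (neutral jet at a rung, `j = P`). -/
theorem jetDiag_eq_ratePi (a Gpi j : ℝ) : -1 + (1 - a * j) * (-Gpi) = ratePi a Gpi j := by
  unfold ratePi
  ring

/-- Proposition 16.2 at `j = 1`: the rate of `W_x(π,τ)` is `-(1 + (1-a)·G(π))` (Chen 2021, the
closed ODE for `ω_x(π,t)`, in similarity variables). -/
theorem jetDiag_one (a Gpi : ℝ) : ratePi a Gpi 1 = -(1 + (1 - a) * Gpi) := by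
  unfold ratePi
  ring

end Summit.NavierStokesRegularity.OSWSelfSimilar.Mechanism
end
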